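import Literature.Analysis.OperatorTheory.Enflo2023.CaseIIBranch
import HarnessLib

/-!
# Enflo (2023), Part A p.13: ONE printed Case II stage of (26) — the stage package, and (27) along the branch

Source under adjudication: Per H. Enflo, *On the invariant subspace problem in Hilbert spaces*, arXiv:2305.15442
(v2, 2024), bib key `Enflo2023`.  [cite: Enflo2023, v2 p.12, Case I / Case II (tex L386–L404); p.13, eq. (26)–(27)
(tex L409–L415) and the sentence after (27) (tex L421–L431): "Equation (27) gives `⟨ℓ'(T)y₁', x₀ − ℓ'(T)y₁'⟩ <
εθ(1 − 1/20)` … every time we apply Lemma 2 we either get Case I and we are done, or we get Case II and pass to a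
smaller `εθ`"; p.14, before (28): "assume that we have arrived at Case I" (tex L443–L450).]

This module is os-F3b / BLOCK-2b repair-cell work (`pub-enflo`): kernel-checked statements ABOUT single steps of
the manuscript (formaliser 1, Part A).  NOTHING here asserts the manuscript's main theorem; no declaration
concludes the invariant subspace problem for an arbitrary operator.

WHAT IS PROVED.  Setting of (26): `‖T‖ ≤ 10⁻²⁰`, `‖x₀‖ = 1`, `⟨x₀ − y, y⟩ = εθ ∈ (0, 10⁻⁴]`, `‖x₀ − y‖ ≤ 0.7`,
`a` THE minimiser of (26) (radius `‖x₀ − (1 + εθ/10)y‖`), `y' = ℓ'(T)y = V_y a`, `(εθ)' = ⟨x₀ − y', y'⟩`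
(`= C'‖a‖²`, real).

1. `CaseII.stage_facts_of_caseII` / `CaseII.stage_bounds_of_caseII` — the **single-stage package**: from Case II
   AS PRINTED at `y` ALONE (`|⟨x₀ − y, T^j y⟩| ≤ (εθ)⁴`, `j ≥ 1`; nothing assumed at `y'`):
   `‖y' − y‖ ≤ 0.11·εθ`, `0.89εθ ≤ C'·Re a₀ ≤ 1.11εθ`, `1 + δ − Re a₀ ≤ 0.0051εθ`, `Re a₀ ≥ 1`, `C' ≤ 1.11εθ`,
   `0 ≤ (εθ)' ≤ 1.12·εθ`, `‖x₀ − y'‖ ≤ ‖x₀ − y‖`, `‖y'‖ ≤ 1`, and (9) at `y'`: `|⟨x₀ − y', T^m y'⟩| ≤ (εθ)'` for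
   all `m`.  These are steps (D1)–(D3) of `CaseII.factor_of_caseII_twice` (`CaseIIBranch.lean`), which hold at the
   LAST Case II stage of a run — the stage whose successor is Case I (the "exit stage", packet STEPS S17 / B7): this
   is exactly what the Case I part of the argument ((25), Lemma 2, (33)) receives from the Case II iteration.
2. `CaseII.twice_facts_of_caseII` — with Case II as printed ALSO at `y'`: `‖La‖ ≤ 1.5·10⁻⁴(εθ)²`,
   `‖Σ_{j≥1} a_j T^j y‖ ≤ 3·10⁻²⁴(εθ)²`, `1 + δ − Re a₀ ≤ 3.4·10⁻¹⁷(εθ)²`, `|Im a₀| ≤ 6·10⁻²⁴(εθ)²`.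
3. `CaseII.eq27_of_caseII_twice` — **(27) HOLDS along the branch**: under the hypotheses of 2,
   `‖ℓ'(T)y − (1 + δ)y‖ ≤ 4·10⁻¹⁷(εθ)² < (εθ)²`.  So the printed (27) — false for THE minimiser at a single Case II
   stage (`CaseII.eq27_false_for_minimal`, the aligned regime, where the next stage is Case I:
   `CaseII.aligned_witness_exits_caseII`) — is TRUE whenever Case II (as printed) holds at the next stage as well,
   i.e. at every stage but the last of the text's "Case II happens every time" branch.  (The referee report of the
   cell, REFEREE.md §23.3 F1-V11, states this in prose with constant `10⁻²²(εθ)²`; the kernel constant is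
   `4·10⁻¹⁷(εθ)²` — the dominant term is `β = 1 + δ − Re a₀ ≤ 3.4·10⁻⁹(εθ)⁴ ≤ 3.4·10⁻¹⁷(εθ)²`.)

MECHANISM: the identities of `CaseIIBranch.lean` / `CaseIIMoves.lean` (pure KKT): `‖w‖² = δ²‖y‖² − 2εθ(1 + δ −
Re a₀) + 2Re E₂` (`norm_sq_displacement_eq_gen`), the head equation `C'Re a₀ = εθ − Re⟨y, w⟩`
(`mul_re_head_eq_sub`) and its imaginary twin `(C' + ‖y‖²)·Im a₀ = −Im⟨y, w₁⟩` (from `kkt_head_displacement`),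
the tail inequality (`tail_inequality`), the Case II envelope (`caseII_envelope`, `norm_inner_V_T_le`); all
arithmetic is `linarith` over explicitly supplied products.  Origin: planner-b2b-enflo-1-g8-0 (F1 gen-8), 2026-08-19.
-/

noncomputable section

open scoped InnerProductSpace ENNReal
open Literature.Analysis.UnboundedOperators (inner_self_eq_coe_norm_sq)

namespace Literature.Analysis.OperatorTheory.Enflo2023

variable {H : Type*} [NormedAddCommGroup H] [InnerProductSpace ℂ H] [CompleteSpace H]

namespace CaseII

open Vy

/-! ### One printed Case II stage: steps (D1)–(D3) of `factor_of_caseII_twice`, no hypothesis at the next stage -/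

/-- **The single-stage package (multiplier form).**  `‖T‖ ≤ 10⁻²⁰`, `‖x₀‖ = 1`, `⟨x₀ − y, y⟩ = εθ ∈ (0, 10⁻⁴]`,
`‖x₀ − y‖ ≤ 0.7`, Case II as printed at `y` (`|⟨x₀ − y, T^j y⟩| ≤ (εθ)⁴`, `j ≥ 1`), `a` THE minimiser of (26) with
multiplier `C' ≥ 0` in (5).  Then, with `w = V_y a − y`, `w₁ = V_y(S(La)) = Σ_{j≥1} a_j T^j y`:
`‖w‖ ≤ 0.11εθ`; `0.89εθ ≤ C'·Re a₀ ≤ 1.11εθ`; `1 + δ − Re a₀ ≤ 0.0051εθ`; `Re a₀ ≥ 1`; `C' ≤ 1.11εθ`;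
`(εθ)' = C'‖a‖² ≤ 1.12εθ`; the leak bounds `|⟨x₀ − y, w₁⟩| ≤ 2·10⁻⁵(εθ)³‖La‖` and
`|⟨x₀ − y, T V_w(La)⟩| ≤ 2·10⁻⁵(εθ)³(2‖a‖ + 1)‖La‖`.  NOTHING is assumed at the next stage. [cite: Enflo2023, v2 p.12 (Case II, tex L400); p.13, eq. (26), tex L409–L411] -/
theorem stage_facts_of_caseII (T : H →L[ℂ] H) (hT1 : ‖T‖ < 1) (hT : ‖T‖ ≤ 1 / 10 ^ 20)
    (x₀ y : H) (et : ℝ) (a : ℓ2) (h0 : ‖x₀‖ = 1) (ht : ⟪x₀ - y, y⟫_ℂ = et) (het : 0 < et)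
    (het1 : et ≤ 1 / 10 ^ 4) (hd : ‖x₀ - y‖ ≤ 0.7)
    (hII : ∀ j, 1 ≤ j → ‖⟪x₀ - y, (T ^ j) y⟫_ℂ‖ ≤ et ^ 4)
    (hmin : IsMinimal (V T hT1 y) x₀ ‖x₀ - ((1 + et / 10 : ℝ) : ℂ) • y‖ a)
    {C : ℝ} (hC0 : 0 ≤ C) (hC : ContinuousLinearMap.adjoint (V T hT1 y) (x₀ - V T hT1 y a) = (C : ℂ) • a) :
    ‖V T hT1 y a - y‖ ≤ 0.11 * et
    ∧ 0.89 * et ≤ C * (a 0).re ∧ C * (a 0).re ≤ 1.11 * et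
    ∧ 1 + et / 10 - (a 0).re ≤ 0.0051 * et ∧ 1 ≤ (a 0).re
    ∧ C ≤ 1.11 * et ∧ C * ‖a‖ ^ 2 ≤ 1.12 * et
    ∧ ‖⟪x₀ - y, V T hT1 y (S (L a))⟫_ℂ‖ ≤ 2 / 10 ^ 5 * et ^ 3 * ‖L a‖
    ∧ ‖⟪x₀ - y, T (V T hT1 (V T hT1 y a - y) (L a))⟫_ℂ‖
        ≤ 2 / 10 ^ 5 * et ^ 3 * (2 * ‖a‖ + 1) * ‖L a‖ := by
  -- the setting of (26)
  have hre : (⟪x₀ - y, y⟫_ℂ).re = et := by rw [ht, Complex.ofReal_re]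
  have hy1 : ‖y‖ ≤ 1 := norm_move_le_one x₀ y h0 (by rw [hre]; exact het.le)
  have hY1 : ‖y‖ ^ 2 ≤ 1 := pow_le_one₀ (norm_nonneg y) hy1
  have hysq : ‖y‖ ^ 2 = 1 - ‖x₀ - y‖ ^ 2 - 2 * et := by rw [norm_sq_move x₀ y h0, hre]
  have hd1 : ‖x₀ - y‖ ≤ 1 := by linarith only [hd]
  have hrad : ‖x₀ - ((1 + et / 10 : ℝ) : ℂ) • y‖ ≤ ‖x₀ - y‖ :=
    radius_le_norm_sub x₀ y et hre (by linarith only [hY1])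
  have hrad1 : ‖x₀ - ((1 + et / 10 : ℝ) : ℂ) • y‖ < ‖x₀‖ := by rw [h0]; linarith only [hrad, hd]
  have hact : ‖x₀ - V T hT1 y a‖ = ‖x₀ - ((1 + et / 10 : ℝ) : ℂ) • y‖ := hmin.norm_sub_eq hrad1
  have hna : ‖a‖ ≤ 1 + et / 10 := norm_minimal_le_of_smul_feasible T hT1 (by linarith only [het]) hmin le_rfl
  have ha0le : ‖a 0‖ ≤ ‖a‖ := lp.norm_apply_le_norm (by norm_num) a 0
  have hu : (a 0).re ≤ 1 + et / 10 :=
    le_trans (le_trans (le_abs_self _) (Complex.abs_re_le_norm _)) (le_trans ha0le hna)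
  have hβ0 : 0 ≤ 1 + et / 10 - (a 0).re := sub_nonneg.2 hu
  have hX0 : 0 ≤ ‖L a‖ := norm_nonneg _
  have hLa : ‖L a‖ ≤ ‖a‖ :=
    (pow_le_pow_iff_left₀ (norm_nonneg _) (norm_nonneg _) two_ne_zero).1
      (by rw [norm_L_apply_sq]; linarith only [sq_nonneg ‖a 0‖])
  have hna1 : ‖a‖ ≤ 1.00001 := by linarith only [hna, het1]
  have hX1 : ‖L a‖ ≤ 1.00001 := by linarith only [hLa, hna1]
  have het3 : 0 ≤ et ^ 3 := pow_nonneg het.le 3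
  have hp3 : et ^ 3 ≤ 1 / 10 ^ 4 * et ^ 2 := by
    calc et ^ 3 = et * et ^ 2 := by ring
      _ ≤ 1 / 10 ^ 4 * et ^ 2 := mul_le_mul_of_nonneg_right het1 (sq_nonneg _)
  -- facts about THE minimiser taken from the tree, then names `w`, `w₁`
  have hdisp := norm_sq_displacement_eq_gen T hT1 x₀ y et a ht hact
  have hhead := mul_re_head_eq_sub T hT1 x₀ y et a hre hC
  set w : H := V T hT1 y a - y with hw_def
  set w₁ : H := V T hT1 y (S (L a)) with hw₁_def
  -- the two leak terms controlled by Case II at `y`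
  have hE2 : ‖⟪x₀ - y, w₁⟫_ℂ‖ ≤ 2 / 10 ^ 5 * et ^ 3 * ‖L a‖ := by
    rw [hw₁_def, V_shift, ← V_apply_T]
    exact norm_inner_V_T_le T hT1 hT (x₀ - y) y hd1 hy1 et het.le hII (L a)
  have hE3 : ‖⟪x₀ - y, T (V T hT1 w (L a))⟫_ℂ‖ ≤ 2 / 10 ^ 5 * et ^ 3 * (2 * ‖a‖ + 1) * ‖L a‖ := by
    rw [← V_apply_T]
    have henv : ∀ j : ℕ, ‖⟪x₀ - y, (T ^ j) (T w)⟫_ℂ‖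
        ≤ (et ^ 3 * (1 / 10 ^ 5) * (2 * ‖a‖ + 1)) * (1 / 10 ^ 5 : ℝ) ^ j := by
      intro j
      have hsplit : (T ^ j) (T w) = V T hT1 ((T ^ j) (T y)) a - (T ^ j) (T y) := by
        rw [hw_def, map_sub, map_sub, V_pow_base, V_apply_T]
      have hVb : ‖⟪x₀ - y, V T hT1 ((T ^ j) (T y)) a⟫_ℂ‖
          ≤ (et ^ 3 * (1 / 10 ^ 5) * (1 / 10 ^ 5 : ℝ) ^ j) * Real.sqrt (1 / (1 - (1 / 10 ^ 5 : ℝ) ^ 2))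
              * ‖a‖ := by
        refine norm_inner_V_le_of_orbit T hT1 (x₀ - y) ((T ^ j) (T y)) a (by positivity) (by norm_num)
          (by norm_num) fun i => ?_
        have hTi : (T ^ i) ((T ^ j) (T y)) = (T ^ (i + j)) (T y) := by rw [pow_add, mul_apply_eq_comp]
        rw [hTi]
        calc ‖⟪x₀ - y, (T ^ (i + j)) (T y)⟫_ℂ‖ ≤ et ^ 3 * (1 / 10 ^ 5) * (1 / 10 ^ 5 : ℝ) ^ (i + j) :=
              caseII_envelope T hT (x₀ - y) y hd1 hy1 et het.le hII (i + j)
          _ = et ^ 3 * (1 / 10 ^ 5) * (1 / 10 ^ 5 : ℝ) ^ j * (1 / 10 ^ 5 : ℝ) ^ i := by rw [pow_add]; ring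
      have hyj := caseII_envelope T hT (x₀ - y) y hd1 hy1 et het.le hII j
      rw [hsplit, inner_sub_right]
      calc ‖⟪x₀ - y, V T hT1 ((T ^ j) (T y)) a⟫_ℂ - ⟪x₀ - y, (T ^ j) (T y)⟫_ℂ‖
          ≤ ‖⟪x₀ - y, V T hT1 ((T ^ j) (T y)) a⟫_ℂ‖ + ‖⟪x₀ - y, (T ^ j) (T y)⟫_ℂ‖ := norm_sub_le _ _
        _ ≤ (et ^ 3 * (1 / 10 ^ 5) * (1 / 10 ^ 5 : ℝ) ^ j) * Real.sqrt (1 / (1 - (1 / 10 ^ 5 : ℝ) ^ 2)) * ‖a‖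
            + et ^ 3 * (1 / 10 ^ 5) * (1 / 10 ^ 5 : ℝ) ^ j := add_le_add hVb hyj
        _ ≤ (et ^ 3 * (1 / 10 ^ 5) * (1 / 10 ^ 5 : ℝ) ^ j) * 2 * ‖a‖
            + et ^ 3 * (1 / 10 ^ 5) * (1 / 10 ^ 5 : ℝ) ^ j := by
              gcongr
              rw [show (2 : ℝ) = Real.sqrt (2 ^ 2) from (Real.sqrt_sq (by norm_num)).symm]
              exact Real.sqrt_le_sqrt (by norm_num)
        _ = (et ^ 3 * (1 / 10 ^ 5) * (2 * ‖a‖ + 1)) * (1 / 10 ^ 5 : ℝ) ^ j := by ring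
    have h := norm_inner_V_le_of_orbit T hT1 (x₀ - y) (T w) (L a) (by positivity) (by norm_num)
      (by norm_num) henv
    calc ‖⟪x₀ - y, V T hT1 (T w) (L a)⟫_ℂ‖
        ≤ (et ^ 3 * (1 / 10 ^ 5) * (2 * ‖a‖ + 1)) * Real.sqrt (1 / (1 - (1 / 10 ^ 5 : ℝ) ^ 2)) * ‖L a‖ := h
      _ ≤ (et ^ 3 * (1 / 10 ^ 5) * (2 * ‖a‖ + 1)) * 2 * ‖L a‖ := by
          gcongr
          rw [show (2 : ℝ) = Real.sqrt (2 ^ 2) from (Real.sqrt_sq (by norm_num)).symm]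
          exact Real.sqrt_le_sqrt (by norm_num)
      _ = 2 / 10 ^ 5 * et ^ 3 * (2 * ‖a‖ + 1) * ‖L a‖ := by ring
  -- (D1) the displacement is small: `‖w‖ ≤ 0.11εθ`
  have hrE2 := abs_le.1 (le_trans (Complex.abs_re_le_norm _) hE2)
  have hq1 : (et / 10) ^ 2 * ‖y‖ ^ 2 ≤ (et / 10) ^ 2 * 1 := mul_le_mul_of_nonneg_left hY1 (sq_nonneg _)
  have hq2 : 0 ≤ et * (1 + et / 10 - (a 0).re) := mul_nonneg het.le hβ0
  have hq3 : 2 / 10 ^ 5 * et ^ 3 * ‖L a‖ ≤ 2 / 10 ^ 5 * et ^ 3 * 1.00001 :=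
    mul_le_mul_of_nonneg_left hX1 (mul_nonneg (by norm_num) het3)
  have hW2 : ‖w‖ ^ 2 ≤ (0.11 * et) ^ 2 := by
    rw [hdisp]; linarith only [hrE2.2, hq1, hq2, hq3, hp3, sq_nonneg et]
  have hW : ‖w‖ ≤ 0.11 * et := (pow_le_pow_iff_left₀ (norm_nonneg _) (by linarith only [het]) two_ne_zero).1 hW2
  have hW0 : 0 ≤ ‖w‖ := norm_nonneg _
  -- (D2) the head: `0.89εθ ≤ C·Re a₀ ≤ 1.11εθ`
  have hyw := abs_le.1 (le_trans (Complex.abs_re_le_norm _) (norm_inner_le_norm y w))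
  have hyW : ‖y‖ * ‖w‖ ≤ 1 * (0.11 * et) := mul_le_mul hy1 hW hW0 zero_le_one
  have hCu_lo : 0.89 * et ≤ C * (a 0).re := by rw [hhead]; linarith only [hyw.2, hyW]
  have hCu_hi : C * (a 0).re ≤ 1.11 * et := by rw [hhead]; linarith only [hyw.1, hyW]
  -- (D3) a priori `1 + δ − Re a₀ ≤ 0.0051εθ < δ`, so `Re a₀ ≥ 1` and `(εθ)' ≤ 1.12εθ`
  have hβδ : 1 + et / 10 - (a 0).re ≤ 0.0051 * et := by
    refine le_of_mul_le_mul_left ?_ (by linarith only [het] : 0 < 2 * et)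
    linarith only [sq_nonneg ‖w‖, hdisp, hrE2.2, hq1, hq3, hp3, sq_nonneg et]
  have hu1 : 1 ≤ (a 0).re := by linarith only [hβδ, het1, het]
  have hC_hi : C ≤ 1.11 * et := le_trans (le_mul_of_one_le_right hC0 hu1) hCu_hi
  have hna2 : ‖a‖ ^ 2 ≤ (1 + et / 10) ^ 2 := pow_le_pow_left₀ (norm_nonneg a) hna 2
  have hsq1 : (1 + et / 10) ^ 2 ≤ 1.000021 := by
    linarith only [mul_le_mul het1 het1 het.le (by norm_num : (0:ℝ) ≤ 1 / 10 ^ 4), het1, het]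
  have het'hi : C * ‖a‖ ^ 2 ≤ 1.12 * et := by
    calc C * ‖a‖ ^ 2 ≤ C * (1 + et / 10) ^ 2 := mul_le_mul_of_nonneg_left hna2 hC0
      _ ≤ (1.11 * et) * 1.000021 := mul_le_mul hC_hi hsq1 (sq_nonneg _) (by linarith only [het])
      _ ≤ 1.12 * et := by linarith only [het]
  exact ⟨hW, hCu_lo, hCu_hi, hβδ, hu1, hC_hi, het'hi, hE2, hE3⟩

/-- **The single-stage package (user form) — what the exit stage hands to the Case I part.**  Same setting, Case II
as printed at `y` only, `a` THE minimiser of (26), `y' = V_y a`, `(εθ)' := Re⟨x₀ − y', y'⟩`.  Then: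
`‖y' − y‖ ≤ 0.11εθ`; `⟨x₀ − y', y'⟩ = (εθ)'` is REAL with `0 ≤ (εθ)' ≤ 1.12εθ` (it need NOT have decreased — the
factor `0.9491` needs Case II at `y'` too, `factor_of_caseII_twice`; a bound `> 1` cannot be excluded by this
package); `‖x₀ − y'‖ ≤ ‖x₀ − y‖` (the new point is at least as close to `x₀`); `‖y'‖ ≤ 1`; and (9) holds at `y'`:
`|⟨x₀ − y', T^m y'⟩| ≤ (εθ)'` for every `m ≥ 0` (the hypothesis `h9` of `Lemma2.lemma2_coeff` at the next point, with
`t = (εθ)'`). [cite: Enflo2023, v2 p.4, eq. (9); p.12 (Case II); p.13, eq. (26); p.14 ("assume that we have arrived at Case I", tex L443–L450)] -/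
theorem stage_bounds_of_caseII (T : H →L[ℂ] H) (hT1 : ‖T‖ < 1) (hT : ‖T‖ ≤ 1 / 10 ^ 20)
    (x₀ y : H) (et : ℝ) (a : ℓ2) (h0 : ‖x₀‖ = 1) (ht : ⟪x₀ - y, y⟫_ℂ = et) (het : 0 < et)
    (het1 : et ≤ 1 / 10 ^ 4) (hd : ‖x₀ - y‖ ≤ 0.7)
    (hII : ∀ j, 1 ≤ j → ‖⟪x₀ - y, (T ^ j) y⟫_ℂ‖ ≤ et ^ 4)
    (hmin : IsMinimal (V T hT1 y) x₀ ‖x₀ - ((1 + et / 10 : ℝ) : ℂ) • y‖ a) :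
    ‖V T hT1 y a - y‖ ≤ 0.11 * et
    ∧ ⟪x₀ - V T hT1 y a, V T hT1 y a⟫_ℂ = (((⟪x₀ - V T hT1 y a, V T hT1 y a⟫_ℂ).re : ℝ) : ℂ)
    ∧ 0 ≤ (⟪x₀ - V T hT1 y a, V T hT1 y a⟫_ℂ).re
    ∧ (⟪x₀ - V T hT1 y a, V T hT1 y a⟫_ℂ).re ≤ 1.12 * et
    ∧ ‖x₀ - V T hT1 y a‖ ≤ ‖x₀ - y‖
    ∧ ‖V T hT1 y a‖ ≤ 1
    ∧ ∀ m : ℕ, ‖⟪x₀ - V T hT1 y a, (T ^ m) (V T hT1 y a)⟫_ℂ‖ ≤ (⟪x₀ - V T hT1 y a, V T hT1 y a⟫_ℂ).re := by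
  have hre : (⟪x₀ - y, y⟫_ℂ).re = et := by rw [ht, Complex.ofReal_re]
  have hy1 : ‖y‖ ≤ 1 := norm_move_le_one x₀ y h0 (by rw [hre]; exact het.le)
  have hY1 : ‖y‖ ^ 2 ≤ 1 := pow_le_one₀ (norm_nonneg y) hy1
  have hrad : ‖x₀ - ((1 + et / 10 : ℝ) : ℂ) • y‖ ≤ ‖x₀ - y‖ :=
    radius_le_norm_sub x₀ y et hre (by linarith only [hY1])
  have hrad1 : ‖x₀ - ((1 + et / 10 : ℝ) : ℂ) • y‖ < ‖x₀‖ := by rw [h0]; linarith only [hrad, hd]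
  have ha0 : a ≠ 0 := hmin.ne_zero hrad1
  obtain ⟨C, hC0, hC⟩ := hmin.kkt ha0
  have hact : ‖x₀ - V T hT1 y a‖ = ‖x₀ - ((1 + et / 10 : ℝ) : ℂ) • y‖ := hmin.norm_sub_eq hrad1
  obtain ⟨hW, -, -, -, -, -, het'hi, -, -⟩ :=
    stage_facts_of_caseII T hT1 hT x₀ y et a h0 ht het het1 hd hII hmin hC0 hC
  have het' : ⟪x₀ - V T hT1 y a, V T hT1 y a⟫_ℂ = ((C * ‖a‖ ^ 2 : ℝ) : ℂ) := IsMinimal.eq6 hC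
  have het're : (⟪x₀ - V T hT1 y a, V T hT1 y a⟫_ℂ).re = C * ‖a‖ ^ 2 := by rw [het', Complex.ofReal_re]
  have het'0 : 0 ≤ C * ‖a‖ ^ 2 := mul_nonneg hC0 (sq_nonneg _)
  refine ⟨hW, by rw [het're, het'], by rw [het're]; exact het'0, by rw [het're]; exact het'hi,
    by rw [hact]; exact hrad, norm_move_le_one x₀ _ h0 (by rw [het're]; exact het'0), fun m => ?_⟩
  exact eq9_pow T hT1 y x₀ _ a hmin ha0 m

/-! ### Two consecutive printed Case II stages: the tail, the scaling defect, the phase of `a₀`, and (27) -/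

/-- **Two consecutive printed Case II stages (multiplier form).**  Setting of `stage_facts_of_caseII`, and Case II
as printed ALSO at `y' = V_y a` (`|⟨x₀ − y', T^j y'⟩| ≤ ((εθ)')⁴`, `j ≥ 1`).  Then the tail, the tail vector, the
scaling defect and the phase of the head coefficient of THE minimiser are all `O((εθ)²)`:
`‖La‖ ≤ 1.5·10⁻⁴(εθ)²`, `‖V_y(S(La))‖ = ‖Σ_{j≥1} a_j T^j y‖ ≤ 3·10⁻²⁴(εθ)²`, `1 + δ − Re a₀ ≤ 3.4·10⁻¹⁷(εθ)²`,
`|Im a₀| ≤ 6·10⁻²⁴(εθ)²`; consequently (27): `‖V_y a − (1 + δ)y‖ ≤ 4·10⁻¹⁷(εθ)²`.  (Steps (D5), (D8) of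
`factor_of_caseII_twice`, sharpened: the defect bound there is `1.8(1 + δ − Re a₀) ≤ 10⁻¹²εθ`; the phase bound is the
imaginary part of (5) at `j = 0`, `(C' + ‖y‖²)·Im a₀ = −Im⟨y, Σ_{j≥1} a_j T^j y⟩`.) [cite: Enflo2023, v2 p.12 (Case II, tex L400); p.13, eq. (26)–(27), tex L409–L431] -/
theorem twice_facts_of_caseII (T : H →L[ℂ] H) (hT1 : ‖T‖ < 1) (hT : ‖T‖ ≤ 1 / 10 ^ 20)
    (x₀ y : H) (et : ℝ) (a : ℓ2) (h0 : ‖x₀‖ = 1) (ht : ⟪x₀ - y, y⟫_ℂ = et) (het : 0 < et)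
    (het1 : et ≤ 1 / 10 ^ 4) (hd : ‖x₀ - y‖ ≤ 0.7)
    (hII : ∀ j, 1 ≤ j → ‖⟪x₀ - y, (T ^ j) y⟫_ℂ‖ ≤ et ^ 4)
    (hmin : IsMinimal (V T hT1 y) x₀ ‖x₀ - ((1 + et / 10 : ℝ) : ℂ) • y‖ a)
    (hII' : ∀ j, 1 ≤ j → ‖⟪x₀ - V T hT1 y a, (T ^ j) (V T hT1 y a)⟫_ℂ‖
      ≤ (⟪x₀ - V T hT1 y a, V T hT1 y a⟫_ℂ).re ^ 4)
    {C : ℝ} (hC0 : 0 ≤ C) (hC : ContinuousLinearMap.adjoint (V T hT1 y) (x₀ - V T hT1 y a) = (C : ℂ) • a) :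
    ‖L a‖ ≤ 1.5 / 10 ^ 4 * et ^ 2
    ∧ ‖V T hT1 y (S (L a))‖ ≤ 3 / 10 ^ 24 * et ^ 2
    ∧ 1 + et / 10 - (a 0).re ≤ 3.4 / 10 ^ 17 * et ^ 2
    ∧ |(a 0).im| ≤ 6 / 10 ^ 24 * et ^ 2
    ∧ ‖V T hT1 y a - ((1 + et / 10 : ℝ) : ℂ) • y‖ ≤ 4 / 10 ^ 17 * et ^ 2 := by
  -- the setting of (26)
  have hre : (⟪x₀ - y, y⟫_ℂ).re = et := by rw [ht, Complex.ofReal_re]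
  have hy1 : ‖y‖ ≤ 1 := norm_move_le_one x₀ y h0 (by rw [hre]; exact het.le)
  have hY1 : ‖y‖ ^ 2 ≤ 1 := pow_le_one₀ (norm_nonneg y) hy1
  have hysq : ‖y‖ ^ 2 = 1 - ‖x₀ - y‖ ^ 2 - 2 * et := by rw [norm_sq_move x₀ y h0, hre]
  have hY : 0.5098 ≤ ‖y‖ ^ 2 := by
    rw [hysq]; linarith only [mul_le_mul hd hd (norm_nonneg _) (by norm_num : (0:ℝ) ≤ 0.7), het1]
  have hd1 : ‖x₀ - y‖ ≤ 1 := by linarith only [hd]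
  have hrad : ‖x₀ - ((1 + et / 10 : ℝ) : ℂ) • y‖ ≤ ‖x₀ - y‖ :=
    radius_le_norm_sub x₀ y et hre (by linarith only [hY1])
  have hrad1 : ‖x₀ - ((1 + et / 10 : ℝ) : ℂ) • y‖ < ‖x₀‖ := by rw [h0]; linarith only [hrad, hd]
  have hact : ‖x₀ - V T hT1 y a‖ = ‖x₀ - ((1 + et / 10 : ℝ) : ℂ) • y‖ := hmin.norm_sub_eq hrad1
  have hna : ‖a‖ ≤ 1 + et / 10 := norm_minimal_le_of_smul_feasible T hT1 (by linarith only [het]) hmin le_rfl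
  have ha0le : ‖a 0‖ ≤ ‖a‖ := lp.norm_apply_le_norm (by norm_num) a 0
  have hu : (a 0).re ≤ 1 + et / 10 :=
    le_trans (le_trans (le_abs_self _) (Complex.abs_re_le_norm _)) (le_trans ha0le hna)
  have hβ0 : 0 ≤ 1 + et / 10 - (a 0).re := sub_nonneg.2 hu
  have hX0 : 0 ≤ ‖L a‖ := norm_nonneg _
  have hna1 : ‖a‖ ≤ 1.00001 := by linarith only [hna, het1]
  have hn0 : ‖a 0 - 1‖ ≤ 2.00001 := by
    calc ‖a 0 - 1‖ ≤ ‖a 0‖ + ‖(1 : ℂ)‖ := norm_sub_le _ _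
      _ ≤ 1.00001 + 1 := by rw [norm_one]; linarith only [ha0le, hna1]
      _ = 2.00001 := by norm_num
  have het3 : 0 ≤ et ^ 3 := pow_nonneg het.le 3
  have hp3 : et ^ 3 ≤ 1 / 10 ^ 4 * et ^ 2 := by
    calc et ^ 3 = et * et ^ 2 := by ring
      _ ≤ 1 / 10 ^ 4 * et ^ 2 := mul_le_mul_of_nonneg_right het1 (sq_nonneg _)
  have hp4 : et ^ 4 ≤ 1 / 10 ^ 4 * et ^ 3 := by
    calc et ^ 4 = et * et ^ 3 := by ring
      _ ≤ 1 / 10 ^ 4 * et ^ 3 := mul_le_mul_of_nonneg_right het1 het3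
  have hp5 : et ^ 5 ≤ 1 / 10 ^ 4 * et ^ 4 := by
    calc et ^ 5 = et * et ^ 4 := by ring
      _ ≤ 1 / 10 ^ 4 * et ^ 4 := mul_le_mul_of_nonneg_right het1 (by positivity)
  -- the next stage: `(εθ)' = C‖a‖²` (real, `≥ 0`), `‖y'‖ ≤ 1`, `‖x₀ − y'‖ ≤ 1`
  have het' : ⟪x₀ - V T hT1 y a, V T hT1 y a⟫_ℂ = ((C * ‖a‖ ^ 2 : ℝ) : ℂ) := IsMinimal.eq6 hC
  have het're : (⟪x₀ - V T hT1 y a, V T hT1 y a⟫_ℂ).re = C * ‖a‖ ^ 2 := by rw [het', Complex.ofReal_re]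
  rw [het're] at hII'
  have het'0 : 0 ≤ C * ‖a‖ ^ 2 := mul_nonneg hC0 (sq_nonneg _)
  have hy'1 : ‖V T hT1 y a‖ ≤ 1 := norm_move_le_one x₀ _ h0 (by rw [het're]; exact het'0)
  have hxy'1 : ‖x₀ - V T hT1 y a‖ ≤ 1 := by rw [hact]; linarith only [hrad, hd]
  -- the single-stage package, the identities, then names `w`, `w₁`
  obtain ⟨hW, hCu_lo, hCu_hi, hβδ, hu1, hC_hi, het'hi, hE2, hE3⟩ :=
    stage_facts_of_caseII T hT1 hT x₀ y et a h0 ht het het1 hd hII hmin hC0 hC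
  have hdisp := norm_sq_displacement_eq_gen T hT1 x₀ y et a ht hact
  have htail := tail_inequality T hT1 x₀ y a hC0 hC
  have hheadC := kkt_head_displacement T hT1 x₀ y a hC
  have hw₁le' := norm_V_sub_head_le T hT1 y a
  rw [V_decomp T hT1 y a, add_sub_cancel_left, ← V_shift] at hw₁le'
  have hVa : V T hT1 y a = a 0 • y + V T hT1 y (S (L a)) := by rw [V_shift]; exact V_decomp T hT1 y a
  set w : H := V T hT1 y a - y with hw_def
  set w₁ : H := V T hT1 y (S (L a)) with hw₁_def
  have hw_eq : w = (a 0 - 1) • y + w₁ := by rw [hw_def, hVa, sub_smul, one_smul]; abel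
  have hW0 : 0 ≤ ‖w‖ := norm_nonneg _
  -- constants of the text: `‖T‖ ≤ 10⁻²⁰`
  have hT2 : ‖T‖ ^ 2 ≤ 1 / 10 ^ 40 := by
    calc ‖T‖ ^ 2 ≤ (1 / 10 ^ 20) ^ 2 := pow_le_pow_left₀ (norm_nonneg _) hT 2
      _ = 1 / 10 ^ 40 := by norm_num
  have h1T0 : 0 < 1 - ‖T‖ ^ 2 := by linarith only [hT2]
  have h1T : 0 ≤ 1 / (1 - ‖T‖ ^ 2) := div_nonneg zero_le_one h1T0.le
  have h1T2 : 1 / (1 - ‖T‖ ^ 2) ≤ 2 := by rw [div_le_iff₀ h1T0]; linarith only [hT2]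
  have hsT : Real.sqrt (1 / (1 - ‖T‖ ^ 2)) ≤ 2 := by
    rw [show (2 : ℝ) = Real.sqrt (2 ^ 2) from (Real.sqrt_sq (by norm_num)).symm]
    exact Real.sqrt_le_sqrt (by linarith only [h1T2])
  have hfrac : ‖T‖ ^ 2 * (1 / (1 - ‖T‖ ^ 2)) ≤ 1 / 10 ^ 40 * 2 := mul_le_mul hT2 h1T2 h1T (by norm_num)
  have hW₁ : ‖w₁‖ ≤ 2 / 10 ^ 20 * ‖L a‖ := by
    calc ‖w₁‖ ≤ ‖T‖ * (‖y‖ * Real.sqrt (1 / (1 - ‖T‖ ^ 2))) * ‖L a‖ := hw₁le'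
      _ ≤ 1 / 10 ^ 20 * (1 * 2) * ‖L a‖ := by gcongr
      _ = 2 / 10 ^ 20 * ‖L a‖ := by ring
  -- the leak term controlled by Case II at `y'`
  have hE1 : ‖⟪x₀ - V T hT1 y a, V T hT1 (V T hT1 y a) (S (L a))⟫_ℂ‖
      ≤ 2 / 10 ^ 5 * (C * ‖a‖ ^ 2) ^ 3 * ‖L a‖ := by
    rw [V_shift, ← V_apply_T]
    exact norm_inner_V_T_le T hT1 hT _ _ hxy'1 hy'1 _ het'0 hII' (L a)
  have het'3 : (C * ‖a‖ ^ 2) ^ 3 ≤ (1.12 * et) ^ 3 := pow_le_pow_left₀ het'0 het'hi 3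
  -- (D5) the tail inequality forces `‖La‖ ≤ 1.5·10⁻⁴(εθ)²`
  have hp1 : 0.89 * et * ‖L a‖ ^ 2 ≤ C * (a 0).re * ‖L a‖ ^ 2 := mul_le_mul_of_nonneg_right hCu_lo (sq_nonneg _)
  have hpz : ‖w‖ * (‖T‖ ^ 2 * (1 / (1 - ‖T‖ ^ 2)) * ‖y‖) * ‖L a‖ ^ 2
      ≤ (0.11 * et) * (1 / 10 ^ 40 * 2 * 1) * ‖L a‖ ^ 2 := by
    refine mul_le_mul_of_nonneg_right ?_ (sq_nonneg _)
    refine mul_le_mul hW ?_ (mul_nonneg (mul_nonneg (sq_nonneg _) h1T) (norm_nonneg _)) (by linarith only [het])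
    exact mul_le_mul hfrac hy1 (norm_nonneg _) (by norm_num)
  have hpE3 : 2 / 10 ^ 5 * et ^ 3 * (2 * ‖a‖ + 1) * ‖L a‖ ≤ 2 / 10 ^ 5 * et ^ 3 * 3.00002 * ‖L a‖ :=
    mul_le_mul_of_nonneg_right (mul_le_mul_of_nonneg_left (by linarith only [hna1]) (mul_nonneg (by norm_num) het3)) hX0
  have hpE1 : 2 / 10 ^ 5 * (C * ‖a‖ ^ 2) ^ 3 * ‖L a‖ ≤ 2 / 10 ^ 5 * (1.12 * et) ^ 3 * ‖L a‖ :=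
    mul_le_mul_of_nonneg_right (mul_le_mul_of_nonneg_left het'3 (by norm_num)) hX0
  have hpE2 : ‖a 0 - 1‖ * ‖⟪x₀ - y, w₁⟫_ℂ‖ ≤ 2.00001 * (2 / 10 ^ 5 * et ^ 3 * ‖L a‖) :=
    mul_le_mul hn0 hE2 (norm_nonneg _) (by norm_num)
  have hp0 : 0 ≤ et * ‖L a‖ ^ 2 := mul_nonneg het.le (sq_nonneg _)
  have hp00 : 0 ≤ et ^ 3 * ‖L a‖ := mul_nonneg het3 hX0
  have hq : et * (0.88 * ‖L a‖ ^ 2) ≤ et * (1.3 / 10 ^ 4 * et ^ 2 * ‖L a‖) := by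
    linarith only [htail, hp1, hpz, hpE3, hpE1, hpE2, hE3, hE1, hp0, hp00]
  have hq' : 0.88 * ‖L a‖ ^ 2 ≤ 1.3 / 10 ^ 4 * et ^ 2 * ‖L a‖ := le_of_mul_le_mul_left hq het
  have hX : ‖L a‖ ≤ 1.5 / 10 ^ 4 * et ^ 2 := by
    rcases hX0.eq_or_lt with hX00 | hXpos
    · rw [← hX00]; positivity
    · have h : ‖L a‖ * (0.88 * ‖L a‖) ≤ ‖L a‖ * (1.3 / 10 ^ 4 * et ^ 2) := by linarith only [hq']
      have := le_of_mul_le_mul_left h hXpos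
      linarith only [this, sq_nonneg et]
  have hW₁' : ‖w₁‖ ≤ 3 / 10 ^ 24 * et ^ 2 := by linarith only [hW₁, hX]
  have hW₁0 : 0 ≤ ‖w₁‖ := norm_nonneg _
  -- (D8, sharpened) the scaling is exhausted up to `3.4·10⁻¹⁷(εθ)²`
  have hn0y : ‖a 0 - 1‖ * ‖y‖ ≤ ‖w‖ + ‖w₁‖ := by
    have h : (a 0 - 1) • y = w - w₁ := by rw [hw_eq]; abel
    rw [← norm_smul, h]; exact norm_sub_le _ _
  have hp6 : ((a 0).re - 1) ^ 2 ≤ ‖a 0 - 1‖ ^ 2 := by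
    have h := Complex.abs_re_le_norm (a 0 - 1)
    rw [Complex.sub_re, Complex.one_re] at h
    rw [← sq_abs]; exact pow_le_pow_left₀ (abs_nonneg _) h 2
  have hp7 : (‖a 0 - 1‖ * ‖y‖) ^ 2 ≤ (‖w‖ + ‖w₁‖) ^ 2 := pow_le_pow_left₀ (by positivity) hn0y 2
  have hp67 : ((a 0).re - 1) ^ 2 * ‖y‖ ^ 2 ≤ (‖w‖ + ‖w₁‖) ^ 2 :=
    le_trans (mul_le_mul_of_nonneg_right hp6 (sq_nonneg _)) (by rw [← mul_pow]; exact hp7)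
  have hβ2Y : 0 ≤ (1 + et / 10 - (a 0).re) ^ 2 * ‖y‖ ^ 2 := mul_nonneg (sq_nonneg _) (sq_nonneg _)
  have hrE2n : (⟪x₀ - y, w₁⟫_ℂ).re ≤ ‖⟪x₀ - y, w₁⟫_ℂ‖ :=
    le_trans (le_abs_self _) (Complex.abs_re_le_norm _)
  have hq2 : 0 ≤ et * (1 + et / 10 - (a 0).re) := mul_nonneg het.le hβ0
  have hβmain : et * (1 + et / 10 - (a 0).re) * (2 - 0.2 * ‖y‖ ^ 2)
      ≤ 2 * ‖⟪x₀ - y, w₁⟫_ℂ‖ + 2 * ‖w‖ * ‖w₁‖ + ‖w₁‖ ^ 2 := by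
    linarith only [hdisp, hp67, hrE2n, hβ2Y]
  have hr1 : 2 * ‖⟪x₀ - y, w₁⟫_ℂ‖ ≤ 2 * (2 / 10 ^ 5 * et ^ 3 * (1.5 / 10 ^ 4 * et ^ 2)) := by
    have := mul_le_mul_of_nonneg_left hX (mul_nonneg (by norm_num : (0:ℝ) ≤ 2 / 10 ^ 5) het3)
    linarith only [this, hE2]
  have hr2 : 2 * ‖w‖ * ‖w₁‖ ≤ 2 * (0.11 * et) * (3 / 10 ^ 24 * et ^ 2) := by
    have := mul_le_mul hW hW₁' hW₁0 (by linarith only [het])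
    linarith only [this]
  have hr3 : ‖w₁‖ ^ 2 ≤ (3 / 10 ^ 24 * et ^ 2) ^ 2 := pow_le_pow_left₀ hW₁0 hW₁' 2
  have hlow : et * (1 + et / 10 - (a 0).re) * 1.8 ≤ et * (1 + et / 10 - (a 0).re) * (2 - 0.2 * ‖y‖ ^ 2) :=
    mul_le_mul_of_nonneg_left (by linarith only [hY1]) hq2
  have hβZ : et * (1.8 * (1 + et / 10 - (a 0).re) - 6.12 / 10 ^ 17 * et ^ 2) ≤ 0 := by
    linarith only [hβmain, hr1, hr2, hr3, hlow, hp4, hp5, het3]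
  have hβ : 1 + et / 10 - (a 0).re ≤ 3.4 / 10 ^ 17 * et ^ 2 := by
    have h : 1.8 * (1 + et / 10 - (a 0).re) - 6.12 / 10 ^ 17 * et ^ 2 ≤ 0 :=
      not_lt.1 fun hcon => by linarith only [mul_pos het hcon, hβZ]
    linarith only [h]
  -- the phase of the head coefficient: `(C' + ‖y‖²)·Im a₀ = −Im⟨y, w₁⟩`
  have hyx : ⟪y, x₀ - y⟫_ℂ = (et : ℂ) := by rw [← inner_conj_symm, ht, Complex.conj_ofReal]
  have hF5 : (C + ‖y‖ ^ 2) * (a 0).im = -(⟪y, w₁⟫_ℂ).im := by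
    have h := congrArg Complex.im hheadC
    rw [hyx, hw_eq, inner_add_right, inner_smul_right, inner_self_eq_coe_norm_sq] at h
    simp only [Complex.mul_im, Complex.ofReal_re, Complex.ofReal_im, zero_mul, add_zero, Complex.sub_im,
      Complex.add_im, Complex.sub_re, Complex.one_re, Complex.one_im, sub_zero, mul_zero, zero_sub,
      zero_add] at h
    linarith only [h]
  have hyw1i : |(⟪y, w₁⟫_ℂ).im| ≤ ‖w₁‖ := by
    refine le_trans (Complex.abs_im_le_norm _) (le_trans (norm_inner_le_norm y w₁) ?_)
    calc ‖y‖ * ‖w₁‖ ≤ 1 * ‖w₁‖ := mul_le_mul_of_nonneg_right hy1 hW₁0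
      _ = ‖w₁‖ := one_mul _
  have hIm : |(a 0).im| ≤ 6 / 10 ^ 24 * et ^ 2 := by
    have h1 : |(a 0).im| * 0.5098 ≤ |(a 0).im| * (C + ‖y‖ ^ 2) :=
      mul_le_mul_of_nonneg_left (by linarith only [hC0, hY]) (abs_nonneg _)
    have h2 : |(a 0).im| * (C + ‖y‖ ^ 2) = |(⟪y, w₁⟫_ℂ).im| := by
      rw [← abs_of_nonneg (by linarith only [hC0, hY] : 0 ≤ C + ‖y‖ ^ 2), ← abs_mul, mul_comm, hF5, abs_neg]
    linarith only [h1, h2, hyw1i, hW₁', abs_nonneg (a 0).im]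
  -- (27): `V_y a − (1+δ)y = (a₀ − (1+δ))y + w₁`
  have h27 : ‖V T hT1 y a - ((1 + et / 10 : ℝ) : ℂ) • y‖ ≤ 4 / 10 ^ 17 * et ^ 2 := by
    have hdec : V T hT1 y a - ((1 + et / 10 : ℝ) : ℂ) • y = (a 0 - ((1 + et / 10 : ℝ) : ℂ)) • y + w₁ := by
      rw [hVa, sub_smul]; abel
    have hz : ‖a 0 - ((1 + et / 10 : ℝ) : ℂ)‖ ≤ (1 + et / 10 - (a 0).re) + |(a 0).im| := by
      refine (Complex.norm_le_abs_re_add_abs_im _).trans ?_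
      simp only [Complex.sub_re, Complex.sub_im, Complex.ofReal_re, Complex.ofReal_im, sub_zero]
      rw [abs_of_nonpos (by linarith only [hu])]
      linarith only []
    calc ‖V T hT1 y a - ((1 + et / 10 : ℝ) : ℂ) • y‖ = ‖(a 0 - ((1 + et / 10 : ℝ) : ℂ)) • y + w₁‖ := by
          rw [hdec]
      _ ≤ ‖(a 0 - ((1 + et / 10 : ℝ) : ℂ)) • y‖ + ‖w₁‖ := norm_add_le _ _
      _ = ‖a 0 - ((1 + et / 10 : ℝ) : ℂ)‖ * ‖y‖ + ‖w₁‖ := by rw [norm_smul]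
      _ ≤ ((1 + et / 10 - (a 0).re) + |(a 0).im|) * 1 + 3 / 10 ^ 24 * et ^ 2 :=
          add_le_add (mul_le_mul hz hy1 (norm_nonneg y) (add_nonneg hβ0 (abs_nonneg _))) hW₁'
      _ ≤ 4 / 10 ^ 17 * et ^ 2 := by linarith only [hβ, hIm, sq_nonneg et]
  exact ⟨hX, hW₁', hβ, hIm, h27⟩

/-- **(27) holds along the "Case II every time" branch.**  `‖T‖ ≤ 10⁻²⁰`, `‖x₀‖ = 1`, `⟨x₀ − y, y⟩ = εθ ∈ (0, 10⁻⁴]`,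
`‖x₀ − y‖ ≤ 0.7`, `a` THE minimiser of (26); Case II as printed at `y` AND at `y' = ℓ'(T)y`.  Then
`‖ℓ'(T)y − (1 + δ)y‖ ≤ 4·10⁻¹⁷(εθ)² < (εθ)²` — the printed (27).  Compare `CaseII.eq27_false_for_minimal` (a single
Case II stage in the aligned regime: (27) fails, and the next stage is Case I). [cite: Enflo2023, v2 p.13, eq. (27), tex L413–L415] -/
theorem eq27_of_caseII_twice (T : H →L[ℂ] H) (hT1 : ‖T‖ < 1) (hT : ‖T‖ ≤ 1 / 10 ^ 20)
    (x₀ y : H) (et : ℝ) (a : ℓ2) (h0 : ‖x₀‖ = 1) (ht : ⟪x₀ - y, y⟫_ℂ = et) (het : 0 < et)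
    (het1 : et ≤ 1 / 10 ^ 4) (hd : ‖x₀ - y‖ ≤ 0.7)
    (hII : ∀ j, 1 ≤ j → ‖⟪x₀ - y, (T ^ j) y⟫_ℂ‖ ≤ et ^ 4)
    (hmin : IsMinimal (V T hT1 y) x₀ ‖x₀ - ((1 + et / 10 : ℝ) : ℂ) • y‖ a)
    (hII' : ∀ j, 1 ≤ j → ‖⟪x₀ - V T hT1 y a, (T ^ j) (V T hT1 y a)⟫_ℂ‖
      ≤ (⟪x₀ - V T hT1 y a, V T hT1 y a⟫_ℂ).re ^ 4) :
    ‖V T hT1 y a - ((1 + et / 10 : ℝ) : ℂ) • y‖ ≤ 4 / 10 ^ 17 * et ^ 2 ∧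
      ‖V T hT1 y a - ((1 + et / 10 : ℝ) : ℂ) • y‖ < et ^ 2 := by
  have hre : (⟪x₀ - y, y⟫_ℂ).re = et := by rw [ht, Complex.ofReal_re]
  have hy1 : ‖y‖ ≤ 1 := norm_move_le_one x₀ y h0 (by rw [hre]; exact het.le)
  have hY1 : ‖y‖ ^ 2 ≤ 1 := pow_le_one₀ (norm_nonneg y) hy1
  have hrad : ‖x₀ - ((1 + et / 10 : ℝ) : ℂ) • y‖ ≤ ‖x₀ - y‖ :=
    radius_le_norm_sub x₀ y et hre (by linarith only [hY1])
  have hrad1 : ‖x₀ - ((1 + et / 10 : ℝ) : ℂ) • y‖ < ‖x₀‖ := by rw [h0]; linarith only [hrad, hd]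
  obtain ⟨C, hC0, hC⟩ := hmin.kkt (hmin.ne_zero hrad1)
  obtain ⟨-, -, -, -, h27⟩ := twice_facts_of_caseII T hT1 hT x₀ y et a h0 ht het het1 hd hII hmin hII' hC0 hC
  exact ⟨h27, lt_of_le_of_lt h27 (by nlinarith [sq_nonneg et, pow_pos het 2])⟩

/-- Hence, with the factor: on the branch, at every stage followed by another printed Case II stage BOTH printed
claims hold — (27) and `(εθ)' ≤ (1 − 1/20)εθ` (`factor_of_caseII_twice'`). [cite: Enflo2023, v2 p.13, eq. (27) and tex L421–L431] -/
theorem eq27_and_factor_of_caseII_twice (T : H →L[ℂ] H) (hT1 : ‖T‖ < 1) (hT : ‖T‖ ≤ 1 / 10 ^ 20)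
    (x₀ y : H) (et : ℝ) (a : ℓ2) (h0 : ‖x₀‖ = 1) (ht : ⟪x₀ - y, y⟫_ℂ = et) (het : 0 < et)
    (het1 : et ≤ 1 / 10 ^ 4) (hd : ‖x₀ - y‖ ≤ 0.7)
    (hII : ∀ j, 1 ≤ j → ‖⟪x₀ - y, (T ^ j) y⟫_ℂ‖ ≤ et ^ 4)
    (hmin : IsMinimal (V T hT1 y) x₀ ‖x₀ - ((1 + et / 10 : ℝ) : ℂ) • y‖ a)
    (hII' : ∀ j, 1 ≤ j → ‖⟪x₀ - V T hT1 y a, (T ^ j) (V T hT1 y a)⟫_ℂ‖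
      ≤ (⟪x₀ - V T hT1 y a, V T hT1 y a⟫_ℂ).re ^ 4) :
    ‖V T hT1 y a - ((1 + et / 10 : ℝ) : ℂ) • y‖ < et ^ 2 ∧
      (⟪x₀ - V T hT1 y a, V T hT1 y a⟫_ℂ).re ≤ (1 - 1 / 20) * et :=
  ⟨(eq27_of_caseII_twice T hT1 hT x₀ y et a h0 ht het het1 hd hII hmin hII').2,
    (factor_of_caseII_twice' T hT1 hT x₀ y et a h0 ht het het1 hd hII hmin hII').1⟩

end CaseII

end Literature.Analysis.OperatorTheory.Enflo2023

end
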